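import Summits.QuantumFields.YangMills.Theorems.UnitScaleTiltProp7LocalModelJunction
import Mathlib.Algebra.Order.Chebyshev
import HarnessLib

/-!
# Route `UnitScaleTilt`, crux K1 «MinimiserStabilityRegPr» (stmt-QuantumFields-19200), route-R E′ path (α′), S3 K-form engine, row (H) junction (J-δ) — FILE 9u (brick for F-H9q-Σ):
# TELESCOPING A COARSE TRANSPORT CHAIN — `‖R(S_(n−1)⋯S_0)m_0 − m_n‖ ≤ Σ_(i<n) ‖R(S_i)m_i − m_(i+1)‖` and its Cauchy–Schwarz square, for bi-contractive units `S_i` (the straight coarse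
# transports along a coarse path `y = y_0, y_1, …, y_n = B`) and data `m_i = φ₀(c_(y_i))`: the (J-δ) sub-row of ★p1 g16's `hGJ_pt` (✓p681065's first family with `S y z :=` the path
# transport) telescopes into per-coarse-bond covariant differences `‖R(S_c)φ₀(c.src) − φ₀(c.tgt)‖²` (→ `δ^V` by ✓ `norm_R_sub_le_of_defect`).  Successor routeR-w1 g7's «F-H9q-Σ» count
# consumes this with `n ≤ 2d`.

Cell `ym3-torus`, D-0154 (3c) twin-width seat `ym-routeR-w1` (gen 6); ★p1 g16 WORD 13 (hGJ_pt displayed in v5; (J-δ) count = next file).  THEOREMS ONLY (0 `def`, 0 `sorry`);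
`--supports stmt-QuantumFields-19200`, count-neutral.  YM₃ on T³ is a ladder rung (R3), not the Clay problem; nothing here claims a stub, the crux, d = 4 or the gap.

WHAT (ns `…Theorems.Prop7CoarseTransportChain`; any normed ring): ★ `norm_R_chain_sub_le` (telescoping over `((List.range n).map S).reverse.prod`, ✓ `norm_R_mul_sub_le`), ★ `norm_R_chain_sub_sq_le`
(`… ² ≤ n·Σ_(i<n) ‖R(S_i)m_i − m_(i+1)‖²`, ✓ `sq_sum_le_card_mul_sum_sq`).
HONEST SCOPE.  Pure kinematics of the adjoint transport.

References: T. Bałaban, CMP 99 (1985) 389–434 [Balaban1985BackgroundPropagators] ((3.1) p.390, (3.12) p.392).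
-/

set_option autoImplicit false

noncomputable section

open scoped BigOperators

namespace Summit.QuantumFields.YangMills.Theorems.Prop7CoarseTransportChain

open Literature.MathematicalPhysics.QuantumFieldTheory.Balaban1983to89
open B9Eq39Adjoint (R R_one)
open Summit.QuantumFields.YangMills.Theorems.Prop7LocalModelJunction (norm_R_mul_sub_le)

variable {𝔸 : Type*} [NormedRing 𝔸]

/-- ★ **TELESCOPING A TRANSPORT CHAIN**: `‖R(S_(n−1)⋯S_0)m_0 − m_n‖ ≤ Σ_(i<n) ‖R(S_i)m_i − m_(i+1)‖` for bi-contractive `S_i`.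
[cite: Balaban1985BackgroundPropagators, (3.1) p.390, (3.12) p.392] -/
theorem norm_R_chain_sub_le (S : ℕ → 𝔸ˣ) (hS : ∀ i, ‖(S i : 𝔸)‖ ≤ 1 ∧ ‖(((S i)⁻¹ : 𝔸ˣ) : 𝔸)‖ ≤ 1) (m : ℕ → 𝔸) :
    ∀ n : ℕ, ‖R (((List.range n).map S).reverse.prod) (m 0) - m n‖ ≤ ∑ i ∈ Finset.range n, ‖R (S i) (m i) - m (i + 1)‖
  | 0 => by simp [R_one]
  | n + 1 => by
    rw [List.range_succ, List.map_append, List.reverse_append, List.prod_append, List.map_singleton, List.reverse_singleton,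
      List.prod_singleton, Finset.sum_range_succ]
    exact (norm_R_mul_sub_le (hS n) (m 0) (m n) (m (n + 1))).trans (add_le_add (norm_R_chain_sub_le S hS m n) le_rfl)

/-- ★ **THE SQUARE** (Cauchy–Schwarz): `‖R(S_(n−1)⋯S_0)m_0 − m_n‖² ≤ n·Σ_(i<n) ‖R(S_i)m_i − m_(i+1)‖²`. [cite: Balaban1985BackgroundPropagators, (3.1) p.390, (3.12) p.392] -/
theorem norm_R_chain_sub_sq_le (S : ℕ → 𝔸ˣ) (hS : ∀ i, ‖(S i : 𝔸)‖ ≤ 1 ∧ ‖(((S i)⁻¹ : 𝔸ˣ) : 𝔸)‖ ≤ 1) (m : ℕ → 𝔸) (n : ℕ) :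
    ‖R (((List.range n).map S).reverse.prod) (m 0) - m n‖ ^ 2 ≤ (n : ℝ) * ∑ i ∈ Finset.range n, ‖R (S i) (m i) - m (i + 1)‖ ^ 2 := by
  refine (pow_le_pow_left₀ (norm_nonneg _) (norm_R_chain_sub_le S hS m n) 2).trans ?_
  have cs := sq_sum_le_card_mul_sum_sq (s := Finset.range n) (f := fun i => ‖R (S i) (m i) - m (i + 1)‖)
  rw [Finset.card_range] at cs
  exact cs

end Summit.QuantumFields.YangMills.Theorems.Prop7CoarseTransportChain

end
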